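import Mathlib
import Literature.Topology.FourManifolds.PlanarAchiralWords
import Summits.SmoothPoincare4.SmoothPoincare4.Theorems.ConvexBisectionPlanarAcyclicBisectionRigidityStubWalkLow
import Summits.SmoothPoincare4.SmoothPoincare4.Theorems.ConvexBisectionPlanarAcyclicBisectionRigidityHelperSeamNG
import Summits.SmoothPoincare4.SmoothPoincare4.Theorems.ConvexBisectionPlanarAcyclicBisectionRigidityHelperGramSpan
import HarnessLib

/-!
# Crux `ConvexBisection.PlanarAcyclicBisectionRigidity`, line Sketch — abelianised arc data and
# Hantzsche at word level (`helper_unimodular_of_sphereWord_le3`)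

Item stmt-SmoothPoincare4-15086, skeleton `Cruxes/PlanarAcyclicBisectionRigidity/Lines/Sketch.lean`
v2.3 (lead c2).  Pure algebra over the registered word calculus
`Literature.Topology.FourManifolds.PlanarWords`; nothing topological is assumed.
Sub-namespace `AbArc` — the ABELIANISATION of the arc-data model of `Mod(D_n, ∂)`: exponent-sum
vectors `ev x ∈ ℤⁿ`; a mapping class acts on `ℤⁿ` through its hole permutation (`ev_aut`); the
`0/1` TYPE VECTOR `typeVec n c = ev [c]` of a curve (nonzero in range); `ev (u_i(T_c)) = 𝟙[i ∈ type c]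
· typeVec c` (`ev_u_twist`), so the arc words of the monodromy of a positive factorisation
abelianise to the ROWS OF THE GRAM MATRIX of its types (`ev_u_monodromy`) and equal monodromies give
equal Gram matrices (`gram_eq_of_monodromy_eq`); `NormallyGenerates` gives "the types span `ℤⁿ`"
(`span_typeVec_eq_top_of_normallyGenerates`) and "the types of `A` span `ℤⁿ`" gives `Unimodular n A`
(`unimodular_of_span_typeVec_eq_top`, via `F_nᵃᵇ ≅ ℤⁿ`).  With the landed finite linear algebra
`helper_span_eq_top_of_gram_eq` this proves the registered `helper_unimodular_of_sphereWord_le3`: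
homotopy-sphere words on `n ≤ 3` holes are automatically unimodular — the torsion sector is EMPTY at
`k ≤ 4` (Hantzsche: `|H₁(seam)| = d²`, and at `n = 3` the only `|det| = 2` hole matrices have
`coker(H Hᵀ) = ℤ/4 ≠ (ℤ/2)²`).
-/

noncomputable section

open Literature.Topology.FourManifolds Literature.Topology.FourManifolds.PlanarWords

-- the prescribed namespace `Summit.<S>.<P>.…` repeats `SmoothPoincare4` (S = P = SmoothPoincare4)
set_option linter.dupNamespace false

namespace Summit.SmoothPoincare4.SmoothPoincare4.Theorems.PlanarAcyclicBisectionRigidity.Sketch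

namespace AbArc

open ArcData PGen FreeGroup WalkLow SeamNG

variable {n : ℕ}

/-- The exponent-sum homomorphism `F_n → ℤⁿ` (the abelianisation read in the coordinates of the
free basis `x₀, …, x_{n-1}`), valued in the multiplicative copy of `ℤⁿ`. [folklore] -/
def evHom (n : ℕ) : FreeGroup (Fin n) →* Multiplicative (Fin n → ℤ) :=
  FreeGroup.lift fun j => Multiplicative.ofAdd (Pi.single j 1)

/-- The exponent-sum vector `ev x ∈ ℤⁿ` of a word `x ∈ F_n`. [folklore] -/
def ev (x : FreeGroup (Fin n)) : Fin n → ℤ :=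
  Multiplicative.toAdd (evHom n x)

/-- Exponent sums of a generator: the basis vector. [folklore] -/
@[simp] theorem ev_of (j : Fin n) : ev (of j) = Pi.single j 1 := by
  simp [ev, evHom]

/-- Exponent sums are additive. [folklore] -/
@[simp] theorem ev_mul (x y : FreeGroup (Fin n)) : ev (x * y) = ev x + ev y := by
  simp [ev, toAdd_mul]

/-- Exponent sums of the empty word. [folklore] -/
@[simp] theorem ev_one : ev (1 : FreeGroup (Fin n)) = 0 := by
  simp [ev]

/-- Exponent sums of an inverse. [folklore] -/
@[simp] theorem ev_inv (x : FreeGroup (Fin n)) : ev x⁻¹ = -ev x := by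
  simp [ev, toAdd_inv]

/-- **A mapping class acts on `ℤⁿ = H₁(D_n)` through its hole permutation**: the automorphism
`xᵢ ↦ uᵢ x_{π i} uᵢ⁻¹` abelianises to `eᵢ ↦ e_{π i}`, i.e. `ev (φ_* x) = ev x ∘ π⁻¹`. [folklore] -/
theorem ev_aut (φ : ArcData n) (x : FreeGroup (Fin n)) :
    ev (φ.aut x) = fun i => ev x (φ.perm.symm i) := by
  induction x using FreeGroup.induction_on with
  | C1 => funext i; simp
  | of j =>
      funext i
      rw [aut_of, ev_mul, ev_mul, ev_inv, ev_of, ev_of]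
      simp only [Pi.add_apply, Pi.neg_apply, add_neg_cancel_comm, Pi.single_apply,
        Equiv.symm_apply_eq]
  | inv_of j ih =>
      rw [_root_.map_inv, ev_inv, ih, ev_inv]
      rfl
  | mul x y ihx ihy =>
      rw [_root_.map_mul, ev_mul, ihx, ihy, ev_mul]
      rfl

/-- Exponent sums of a power. [folklore] -/
theorem ev_zpow (x : FreeGroup (Fin n)) (m : ℤ) : ev (x ^ m) = m • ev x := by
  simp [ev, toAdd_zpow]

/-- Abelianised arc words of a composite: `ev (u^{φψ}_i) = ev (u^ψ_i) ∘ π_φ⁻¹ + ev (u^φ_{π_ψ i})`.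
[folklore] -/
theorem ev_mul_u (φ ψ : ArcData n) (i : Fin n) :
    ev ((mul φ ψ).u i) = (fun k => ev (ψ.u i) (φ.perm.symm k)) + ev (φ.u (ψ.perm i)) := by
  rw [mul_u, ev_mul, ev_aut]

/-- For a composite with a NON-PERMUTING left factor the abelianised arc words simply add.
[folklore] -/
theorem ev_mul_u_of_perm_eq_one (φ ψ : ArcData n) (hφ : φ.perm = 1) (i : Fin n) :
    ev ((mul φ ψ).u i) = ev (ψ.u i) + ev (φ.u (ψ.perm i)) := by
  rw [ev_mul_u, hφ]
  rfl

/-- Exponent sums of a product of generators indexed by a list: the letter counts. [folklore] -/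
theorem ev_prod_map_of (L : List (Fin n)) (k : Fin n) :
    ev (L.map of).prod k = (L.count k : ℤ) := by
  induction L with
  | nil => simp
  | cons j L ih =>
      rw [List.map_cons, List.prod_cons, ev_mul, Pi.add_apply, ih, ev_of, List.count_cons,
        Pi.single_apply]
      by_cases h : k = j
      · subst h; simp; ring
      · have : (j == k) = false := by simpa [beq_iff_eq] using Ne.symm h
        simp [h, this]

/-- **Exponent sums of a round block word**: the indicator of the block,
`ev (x_a ⋯ x_b) = 𝟙_{[a,b]}`. [folklore] -/
theorem ev_blockWord (a b : ℕ) (k : Fin n) :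
    ev (blockWord n a b) k = if a ≤ k.val ∧ k.val ≤ b then 1 else 0 := by
  unfold blockWord
  rw [ev_prod_map_of]
  by_cases h : a ≤ k.val ∧ k.val ≤ b
  · rw [if_pos h, List.count_filter (by simpa using h)]
    simp [List.count_eq_one_of_mem (List.nodup_finRange n) (List.mem_finRange k)]
  · rw [if_neg h]
    norm_cast
    refine List.count_eq_zero.2 fun hk => h ?_
    simpa using (List.mem_filter.1 hk).2

/-- **The type vector of a curve** `c = g(c_[a,b])`: the abelianised class `ev [c] ∈ ℤⁿ` — the
indicator of the set of holes it encloses. [folklore] -/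
def typeVec (n : ℕ) (c : PlanarCurve) : Fin n → ℤ :=
  ev (PlanarCurve.cls n c)

/-- The type vector is the block indicator transported by the carrier's hole permutation. [folklore] -/
theorem typeVec_apply (c : PlanarCurve) (i : Fin n) :
    typeVec n c i = if c.a ≤ ((evalWord n c.g).perm.symm i).val ∧ ((evalWord n c.g).perm.symm i).val ≤ c.b
      then 1 else 0 := by
  unfold typeVec PlanarCurve.cls
  rw [ev_aut]
  exact ev_blockWord c.a c.b _

/-- Type vectors are `0/1`-valued. [folklore] -/
theorem typeVec_zero_or_one (c : PlanarCurve) (i : Fin n) : typeVec n c i = 0 ∨ typeVec n c i = 1 := by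
  rw [typeVec_apply]
  split_ifs <;> simp

/-- An in-range curve encloses at least one hole: its type vector is nonzero (the hole `π_g a`
is enclosed). [folklore] -/
theorem typeVec_ne_zero (c : PlanarCurve) (hc : c.InRange n) : typeVec n c ≠ 0 := by
  obtain ⟨hab, hb, -⟩ := hc
  intro h
  have ha : c.a < n := lt_of_le_of_lt hab hb
  have := congrFun h ((evalWord n c.g).perm ⟨c.a, ha⟩)
  rw [typeVec_apply] at this
  simp [hab] at this

/-- **Abelianised arc words of a positive Dehn twist**: `ev (u_i(T_c)) = 𝟙[i ∈ type c] · typeVec c`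
— the twist about `c` changes the arc `δᵢ` (in homology) by the class of `c` exactly when the hole
`i` is enclosed by `c`, and not at all otherwise. [folklore] -/
theorem ev_u_twist (c : PlanarCurve) (i : Fin n) :
    ev ((evalWord n (c.twistWord true)).u i) = if typeVec n c i = 1 then typeVec n c else 0 := by
  -- `T_c = G · T · G⁻¹` with `G · G⁻¹ = 1` on the nose
  set G := evalWord n c.g with hG
  set Gi := evalWord n (invWord c.g) with hGi
  have hone : mul G Gi = one := evalWord_mul_invWord c.g
  have hpermi : Gi.perm = G.perm.symm := by
    have h := congrArg ArcData.perm hone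
    rw [mul_perm, one_perm] at h
    exact eq_inv_of_mul_eq_one_right h
  -- abelianise `u_i(G (T G⁻¹))` and `u_i(G G⁻¹) = 1`
  have h1 : ev ((mul G (mul (data n (round c.a c.b false)) Gi)).u i)
      = (fun k => (ev (Gi.u i) + ev ((data n (round c.a c.b false)).u (Gi.perm i))) (G.perm.symm k))
        + ev (G.u (Gi.perm i)) := by
    rw [ev_mul_u, mul_perm, round_perm, one_mul]
    congr 1
    funext k
    rw [ev_mul_u_of_perm_eq_one _ Gi (round_perm _ _ _)]
  have h0 : (fun k => ev (Gi.u i) (G.perm.symm k)) + ev (G.u (Gi.perm i)) = 0 := by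
    rw [← ev_mul_u, hone, one_u, ev_one]
  rw [twist_eval, ← hG, ← hGi, h1]
  have key : (fun k => (ev (Gi.u i) + ev ((data n (round c.a c.b false)).u (Gi.perm i))) (G.perm.symm k))
        + ev (G.u (Gi.perm i))
      = (fun k => ev ((data n (round c.a c.b false)).u (Gi.perm i)) (G.perm.symm k))
        + ((fun k => ev (Gi.u i) (G.perm.symm k)) + ev (G.u (Gi.perm i))) := by
    funext k; simp only [Pi.add_apply]; ring
  rw [key, h0, add_zero]
  -- the round twist's arc word, abelianised, transported by `π_G`
  funext k
  rw [round_u, hpermi]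
  have htv : ∀ j : Fin n, typeVec n c j = ev (blockWord n c.a c.b) (G.perm.symm j) := fun j => by
    rw [typeVec_apply, ev_blockWord]
  by_cases h : c.a ≤ (G.perm.symm i).val ∧ (G.perm.symm i).val ≤ c.b
  · rw [if_pos h]
    simp only [Bool.false_eq_true, ↓reduceIte]
    have hi : typeVec n c i = 1 := by rw [htv, ev_blockWord, if_pos h]
    rw [if_pos hi, htv]
  · rw [if_neg h, ev_one]
    have hi : typeVec n c i ≠ 1 := by rw [htv, ev_blockWord, if_neg h]; simp
    rw [if_neg hi]
    rfl

/-- The monodromy of a positive factorisation does not permute the holes. [folklore] -/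
theorem perm_monodromy_positiveWord (A : List PlanarCurve) : (monodromy n (positiveWord A)).perm = 1 := by
  induction A with
  | nil => rfl
  | cons c A ih => rw [monodromy_positiveWord_cons, mul_perm, twist_perm, ih, one_mul]

/-- **Abelianised arc words of a positive factorisation = rows of the Gram matrix of its types**:
`ev (u_i(T_{c₁} ⋯ T_{c_m})) = Σ_j 𝟙[i ∈ type cⱼ] · typeVec cⱼ`. [folklore] -/
theorem ev_u_monodromy (A : List PlanarCurve) (i : Fin n) :
    ev ((monodromy n (positiveWord A)).u i) = (A.map fun c => if typeVec n c i = 1 then typeVec n c else 0).sum := by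
  induction A with
  | nil => simp [monodromy_positiveWord_nil]
  | cons c A ih =>
      rw [monodromy_positiveWord_cons, ev_mul_u_of_perm_eq_one _ _ (twist_perm c), ih,
        perm_monodromy_positiveWord, Equiv.Perm.one_apply, ev_u_twist, List.map_cons, List.sum_cons]
      abel

/-- **Equal monodromies have equal Gram matrices of types** (entrywise, as sums over the two
factorisations): the abelian shadow of `monodromy_eq`. [folklore] -/
theorem gram_eq_of_monodromy_eq (A B : List PlanarCurve)
    (hmon : monodromy n (positiveWord A) = monodromy n (positiveWord B)) (i j : Fin n) :
    ((A.map (typeVec n)).map fun s => s i * s j).sum = ((B.map (typeVec n)).map fun s => s i * s j).sum := by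
  have key : ∀ C : List PlanarCurve, ((C.map (typeVec n)).map fun s => s i * s j).sum
      = (C.map fun c => if typeVec n c i = 1 then typeVec n c else 0).sum j := by
    intro C
    induction C with
    | nil => simp
    | cons c C ih =>
        simp only [List.map_cons, List.sum_cons, Pi.add_apply] at ih ⊢
        rw [ih]
        congr 1
        rcases typeVec_zero_or_one c i with h | h
        · rw [h, if_neg (by norm_num)]; simp
        · rw [h, if_pos rfl]; simp
  rw [key, key, ← ev_u_monodromy, ← ev_u_monodromy, hmon]

/-- The exponent-sum homomorphism is surjective (`x_j ↦ e_j`). [folklore] -/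
theorem evHom_surjective : Function.Surjective (evHom n) := by
  intro v
  refine ⟨((List.finRange n).map fun j => of j ^ (Multiplicative.toAdd v j)).prod, ?_⟩
  apply Multiplicative.toAdd.injective
  change ev _ = Multiplicative.toAdd v
  have key : ∀ L : List (Fin n), L.Nodup →
      ev (L.map fun j => of j ^ (Multiplicative.toAdd v j)).prod
        = fun k => if k ∈ L then Multiplicative.toAdd v k else 0 := by
    intro L hL
    induction L with
    | nil => funext k; simp
    | cons j L ih =>
        funext k
        rw [List.map_cons, List.prod_cons, ev_mul, ih hL.of_cons]
        have hj : j ∉ L := (List.nodup_cons.1 hL).1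
        simp only [Pi.add_apply, List.mem_cons, ev_zpow, ev_of, Pi.smul_apply, Pi.single_apply,
          smul_eq_mul]
        by_cases hk : k = j
        · subst hk; simp [hj]
        · simp [hk]
  rw [key _ (List.nodup_finRange n)]
  funext k
  simp [List.mem_finRange]

/-- **`π₁ = 1` abelianised: if the classes of the curves `C` normally generate `F_n`, their type
vectors span `ℤⁿ`.** [folklore] -/
theorem span_typeVec_eq_top_of_normallyGenerates (C : List PlanarCurve) (h : NormallyGenerates n C) :
    Submodule.span ℤ {s | s ∈ C.map (typeVec n)} = ⊤ := by
  -- push the normal closure through the (surjective) exponent-sum map to the abelian group `ℤⁿ`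
  have hmap : Subgroup.map (evHom n) (Subgroup.normalClosure {x | x ∈ C.map (PlanarCurve.cls n)}) = ⊤ := by
    rw [show Subgroup.normalClosure {x | x ∈ C.map (PlanarCurve.cls n)} = ⊤ from h, Subgroup.map_top_of_surjective _ evHom_surjective]
  have hle : Subgroup.map (evHom n) (Subgroup.normalClosure {x | x ∈ C.map (PlanarCurve.cls n)})
      ≤ Subgroup.closure ((evHom n) '' {x | x ∈ C.map (PlanarCurve.cls n)}) := by
    rw [Subgroup.map_le_iff_le_comap]
    refine Subgroup.normalClosure_le_normal ?_
    intro x hx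
    exact Subgroup.subset_closure ⟨x, hx, rfl⟩
  have hcl : Subgroup.closure ((evHom n) '' {x | x ∈ C.map (PlanarCurve.cls n)}) = ⊤ :=
    top_le_iff.1 (hmap ▸ hle)
  -- translate `Subgroup.closure = ⊤` in `Multiplicative ℤⁿ` into `Submodule.span ℤ = ⊤` in `ℤⁿ`
  rw [Submodule.eq_top_iff']
  intro v
  have hv : Multiplicative.ofAdd v ∈ Subgroup.closure ((evHom n) '' {x | x ∈ C.map (PlanarCurve.cls n)}) := by
    rw [hcl]; trivial
  refine Subgroup.closure_induction (p := fun y _ => Multiplicative.toAdd y ∈ Submodule.span ℤ {s | s ∈ C.map (typeVec n)})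
    ?_ ?_ ?_ ?_ hv
  · rintro y ⟨x, hx, rfl⟩
    refine Submodule.subset_span ?_
    simp only [List.mem_map, Set.mem_setOf_eq] at hx ⊢
    obtain ⟨c, hc, rfl⟩ := hx
    exact ⟨c, hc, rfl⟩
  · simp
  · intro y z _ _ hy hz
    simpa [toAdd_mul] using Submodule.add_mem _ hy hz
  · intro y _ hy
    simpa [toAdd_inv] using Submodule.neg_mem _ hy

/-- The exponent-sum map factors through the abelianisation of `F_n`. [folklore] -/
def evAb (n : ℕ) : Abelianization (FreeGroup (Fin n)) →* Multiplicative (Fin n → ℤ) :=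
  Abelianization.lift (evHom n)

/-- A right inverse of `evAb` on `ℤⁿ`: `v ↦ ∏ⱼ x̄ⱼ^{vⱼ}`. [folklore] -/
def abOf (n : ℕ) : Multiplicative (Fin n → ℤ) →* Abelianization (FreeGroup (Fin n)) where
  toFun v := ∏ j : Fin n, (Abelianization.of (of j)) ^ (Multiplicative.toAdd v j)
  map_one' := by simp
  map_mul' v w := by
    rw [← Finset.prod_mul_distrib]
    refine Finset.prod_congr rfl fun j _ => ?_
    rw [toAdd_mul, Pi.add_apply, zpow_add]

/-- `abOf ∘ evAb = id` on `F_nᵃᵇ` (checked on the generators `x̄ⱼ`). [folklore] -/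
theorem abOf_comp_evAb : (abOf n).comp (evAb n) = MonoidHom.id _ := by
  refine Abelianization.hom_ext _ _ (FreeGroup.ext_hom _ _ fun j => ?_)
  simp only [MonoidHom.comp_apply, MonoidHom.id_apply, evAb]
  change abOf n (evHom n (of j)) = Abelianization.of (of j)
  have hev : evHom n (of j) = Multiplicative.ofAdd (Pi.single j 1) := by simp [evHom]
  rw [hev]
  simp only [abOf, MonoidHom.coe_mk, OneHom.coe_mk, toAdd_ofAdd]
  rw [Finset.prod_eq_single j]
  · simp
  · intro k _ hk; simp [hk]
  · simp

/-- `evAb` is injective (it has a left inverse); with `evHom_surjective`, `F_nᵃᵇ ≅ ℤⁿ`. [folklore] -/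
theorem evAb_injective : Function.Injective (evAb n) := by
  intro x y h
  have := congrArg (abOf n) h
  rwa [← MonoidHom.comp_apply, ← MonoidHom.comp_apply, abOf_comp_evAb] at this

/-- **"The types of `A` span `ℤⁿ`" is `Unimodular n A`** (the hole-set matrix is unimodular,
`H₁(X_A; ℤ) = 0`), through `F_nᵃᵇ ≅ ℤⁿ`. [folklore] -/
theorem unimodular_of_span_typeVec_eq_top (A : List PlanarCurve)
    (h : Submodule.span ℤ {s | s ∈ A.map (typeVec n)} = ⊤) : Unimodular n A := by
  unfold Unimodular
  set S : Set (Abelianization (FreeGroup (Fin n))) := {x | x ∈ A.map fun c => Abelianization.of (PlanarCurve.cls n c)}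
  -- the image of `closure S` under `evAb` is everything
  have himg : ∀ v : Fin n → ℤ, Multiplicative.ofAdd v ∈ Subgroup.map (evAb n) (Subgroup.closure S) := by
    intro v
    have hv : v ∈ Submodule.span ℤ {s | s ∈ A.map (typeVec n)} := by rw [h]; trivial
    refine Submodule.span_induction (p := fun v _ => Multiplicative.ofAdd v ∈ Subgroup.map (evAb n) (Subgroup.closure S)) ?_ ?_ ?_ ?_ hv
    · rintro s hs
      simp only [List.mem_map, Set.mem_setOf_eq] at hs
      obtain ⟨c, hc, rfl⟩ := hs
      refine ⟨Abelianization.of (PlanarCurve.cls n c), Subgroup.subset_closure ?_, ?_⟩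
      · simp only [S, List.mem_map, Set.mem_setOf_eq]; exact ⟨c, hc, rfl⟩
      · simp [evAb, typeVec, ev]
    · simp
    · intro v w _ _ hv hw
      rw [ofAdd_add]
      exact Subgroup.mul_mem _ hv hw
    · intro m v _ hv
      rw [ofAdd_zsmul]
      exact Subgroup.zpow_mem _ hv m
  rw [eq_top_iff]
  intro y _
  obtain ⟨z, hz, hzy⟩ := himg (Multiplicative.toAdd (evAb n y))
  rw [ofAdd_toAdd] at hzy
  rwa [← evAb_injective hzy]

end AbArc

open AbArc in
/-- **HANTZSCHE AT WORD LEVEL (registered helper, skeleton v2.3): a homotopy-sphere word on `n ≤ 3`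
holes is integral.**  In-range curves, `n` letters a side, equal monodromies and curves jointly
normally generating `F_n` force BOTH hole matrices to be unimodular: abelianise (`AbArc`) and apply
the finite linear algebra `helper_span_eq_top_of_gram_eq` to the type vectors of `A`, `B` (and of
`B`, `A`).  False from `n = 4` on (the torsion sector is inhabited at `k = 5`). [folklore] -/
theorem helper_unimodular_of_sphereWord_le3 (n : ℕ) (hn : n ≤ 3) (A B : List PlanarCurve)
    (hin : ∀ c ∈ A ++ B, c.InRange n) (hA : A.length = n) (hB : B.length = n)
    (hmon : monodromy n (positiveWord A) = monodromy n (positiveWord B))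
    (hng : NormallyGenerates n (A ++ B)) : Unimodular n A ∧ Unimodular n B := by
  have h01 : ∀ s ∈ A.map (typeVec n) ++ B.map (typeVec n), ∀ i, s i = 0 ∨ s i = 1 := by
    intro s hs i
    rw [← List.map_append, List.mem_map] at hs
    obtain ⟨c, -, rfl⟩ := hs
    exact typeVec_zero_or_one c i
  have hne : ∀ s ∈ A.map (typeVec n) ++ B.map (typeVec n), s ≠ 0 := by
    intro s hs
    rw [← List.map_append, List.mem_map] at hs
    obtain ⟨c, hc, rfl⟩ := hs
    exact typeVec_ne_zero c (hin c hc)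
  have hspan : Submodule.span ℤ {s | s ∈ A.map (typeVec n) ++ B.map (typeVec n)} = ⊤ := by
    rw [← List.map_append]; exact span_typeVec_eq_top_of_normallyGenerates _ hng
  have h01' : ∀ s ∈ B.map (typeVec n) ++ A.map (typeVec n), ∀ i, s i = 0 ∨ s i = 1 :=
    fun s hs => h01 s (by simpa [or_comm] using hs)
  have hne' : ∀ s ∈ B.map (typeVec n) ++ A.map (typeVec n), s ≠ 0 :=
    fun s hs => hne s (by simpa [or_comm] using hs)
  have hspan' : Submodule.span ℤ {s | s ∈ B.map (typeVec n) ++ A.map (typeVec n)} = ⊤ := by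
    rw [← hspan]; congr 1; ext s; simp [or_comm]
  exact ⟨unimodular_of_span_typeVec_eq_top A (helper_span_eq_top_of_gram_eq n hn _ _ (by simpa using hA)
      (by simpa using hB) h01 hne (gram_eq_of_monodromy_eq A B hmon) hspan),
    unimodular_of_span_typeVec_eq_top B (helper_span_eq_top_of_gram_eq n hn _ _ (by simpa using hB)
      (by simpa using hA) h01' hne' (fun i j => (gram_eq_of_monodromy_eq A B hmon i j).symm) hspan')⟩

end Summit.SmoothPoincare4.SmoothPoincare4.Theorems.PlanarAcyclicBisectionRigidity.Sketch

end
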